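import Summits.NavierStokesRegularity.NavierStokesRegularity.Theses.SelfMixingDichotomy

/-!
# Route SelfMixingDichotomy — `Assembly` (item stmt-NavierStokesRegularity-1426)

Pure logic: the route statements of `SelfMixingDichotomy`, in the antecedent order

  `MixingPayoff → CoherentScaleExclusion → SequentialTypeIExclusion → LocalToGlobal →
   NoBlowupToClay → NavierStokesRegularity`,

imply Clay (A). This is, hypothesis for hypothesis, the route's deciding theorem
`Summit.NavierStokesRegularity.NavierStokesRegularity.Theses.SelfMixingDichotomy.closes`; the
proof below is self-contained (it does not invoke `closes`), so that it depends only on the item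
definitions.

Argument. `NoBlowupToClay` reduces `NavierStokesRegularity` to `NoBlowup` (every finite-energy
classical solution on `ℝ³ × [0,T)` from a rapidly decaying datum extends smoothly past `T`, every
`ν > 0`), and `LocalToGlobal` reduces `NoBlowup` to local boundedness `BDD(u,T,x₀)` of every `ν = 1`
such solution at every final-time point `(T, x₀)`. Fix such `u` and `x₀`; take `δ` from
`MixingPayoff` (P) and `M` from `CoherentScaleExclusion` (S2) at `δ`. Suppose `BDD` fails. By
`SequentialTypeIExclusion` (S1) with `M`, the low-Reynolds scales (`C(r) ≤ M`) are not cofinal at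
`0`: there is `r₀ > 0` with `C(r) > M` for all `r ∈ (0, r₀)`. By S2, the non-`δ`-mixing scales with
`M ≤ C(r)` are not cofinal either: there is `r₁ > 0` below which `M ≤ C(r)` forces `MIX(r, δ)`.
Hence every `r ∈ (0, min r₀ r₁)` is `δ`-mixing, and P gives `BDD` — contradiction. The scale
trichotomy {cofinitely mixing} / {i.o. high-Re non-mixing} / {i.o. low-Re} is exhaustive by the
dichotomy `C(r) ≤ M ∨ M < C(r)` in `ℝ≥0∞`; nothing here is new mathematics, the open content lives in
the three cruxes.
-/

namespace Summit.NavierStokesRegularity.NavierStokesRegularity.Theorems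

open Summit.NavierStokesRegularity.NavierStokesRegularity.Theses.SelfMixingDichotomy

/-- **Assembly** (item stmt-NavierStokesRegularity-1426, route SelfMixingDichotomy):
`MixingPayoff → CoherentScaleExclusion → SequentialTypeIExclusion → LocalToGlobal →
NoBlowupToClay → NavierStokesRegularity` — pure logic: `NoBlowupToClay` reduces Clay (A) to
`NoBlowup`, `LocalToGlobal` reduces `NoBlowup` to local boundedness of every `ν = 1` solution at
every final-time point; there, if boundedness failed, S1 pushes the low-Reynolds scales and S2 the
non-mixing high-Reynolds scales above some positive scale, so every smaller scale is `δ`-mixing and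
P gives boundedness. [folklore] -/
theorem selfMixingDichotomy_assembly_proof :
    Summit.NavierStokesRegularity.NavierStokesRegularity.Theses.SelfMixingDichotomy.Assembly := by
  unfold Assembly
  intro hP hS2 hS1 hLG hClay
  -- NoBlowupToClay: NoBlowup (all ν) → Clay (A); LocalToGlobal: BDD at every (T,x₀), ν = 1 → NoBlowup.
  refine hClay (hLG ?_)
  intro T hT u p hcl hLH hdec x₀
  obtain ⟨δ, hδ, hPδ⟩ := hP
  obtain ⟨M, hM⟩ := hS2 δ hδ
  have hP' := hPδ T hT u p hcl hLH hdec x₀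
  have hS2' := hM T hT u p hcl hLH hdec x₀
  have hS1' := hS1 M T hT u p hcl hLH hdec x₀
  -- Scale trichotomy: if BDD failed, S1 says the low-Re scales stop below some r₀, S2 says the
  -- non-mixing high-Re scales stop below some r₁, so every scale below min r₀ r₁ is δ-mixing: P.
  by_contra hnb
  refine hnb (hS1' fun r₀ hr₀ => ?_)
  by_contra hlow
  refine hnb (hS2' fun r₁ hr₁ => ?_)
  by_contra hhigh
  refine hnb (hP' ⟨min r₀ r₁, lt_min hr₀ hr₁, fun r hr => ?_⟩)
  by_contra hmix
  by_cases hle :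
      Literature.Analysis.FluidPDE.cknC r ((T, x₀) : ℝ × EuclideanSpace ℝ (Fin 3)) u ≤
        ENNReal.ofReal M
  · exact hlow ⟨r, ⟨hr.1, lt_of_lt_of_le hr.2 (min_le_left r₀ r₁)⟩, hle⟩
  · exact hhigh ⟨r, ⟨hr.1, lt_of_lt_of_le hr.2 (min_le_right r₀ r₁)⟩, (not_le.mp hle).le, hmix⟩

end Summit.NavierStokesRegularity.NavierStokesRegularity.Theorems
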